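import Summits.NavierStokesRegularity.NavierStokesRegularity.Theorems.SwirlFreeBudget
import HarnessLib

/-!
# ROUND-19 (nsreg-p2, gen 21) — `LogModulusBudget`: the first `b > a` correction of the tower,
# read through Lei–Zhang's form boundedness; the log²-MODULUS CONSTANT of the swirl is the
# exponent of the whole local tower, and the start exponential dissolves in the full CKN gauge

ROUND-18 (tree: `…Theorems.SwirlFreeBudget`) proved the swirl-free end of the tower POLYNOMIAL in
the full CKN gauge `A, C, D ≤ M` (`SwirlFreePolynomialBound` P₀ ⇐ the η-Moser lemma) and typed the
`b > a` correction as the next rung.  ROUND-15 (tree: `…Theorems.SwirlHolderTower`) had already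
located the exponentials of the quantitative axisymmetric theory (Chen–Tsai–Zhang 2022, Ożański–
Palasek 2023) in ONE link — the Arrhenius HÖLDER EXPONENT `γ(M) = exp(-K M^p)` of the swirl at the
axis — and conjectured `PolyHolderLaw` (`γ ≥ (K(1+M)^K)⁻¹`).

**R19's observation.**  The regularity mechanism that consumes the axis behaviour of `Γ = r u_θ`
— Lei–Zhang's form boundedness condition (arXiv:1505.02628, Def. 1.1, Thm 1.2, Cor. 1.3; tree:
`LeiZhang2017FBC.lean` proves (FBC-1)/(FBC-2) with constants `16C₁`, `16C₁²/ln²(2δ)` from the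
modulus `|Γ| ≤ C₁/ln²r`; Seregin 2022 = arXiv:2201.00153 §2 is its LOCAL suitable-weak form, tree
fact `seregin2022_logSwirl_regularAtOrigin`) — never sees a Hölder exponent: it sees ONE NUMBER,
the log²-modulus constant `G = ess sup |Γ|·ln²(1/r)` near the axis, and it converts `G` into a
localisation scale `δ(G) = ½·exp(-G²/√κ)` — the scale at which Lei–Zhang's CLOSURE PRODUCT
`K₀ · δ_* · C_*²` (FBC-2 constant `δ_* = 16G²/ln²(2δ)` times the square of the scale-free FBC-1
constant `C_* = 16G`, the weight of their `3C_*²`-combination of the `J`- and `Ω`-energies) becomes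
the absolute number `4096κ` (`closureProduct_fbcScale`, PROVED) — below which everything is
polynomial in `δ⁻¹ = 2exp(G²/√κ)` (`inv_fbcScale`).  Hence the explicit local bound has the shape
`‖u‖_{L^∞(Q(z₀,1/64))} ≤ K(1+M)^K · exp(K·(1+G(M))²)` (`LogModulusBudget`, the engine conjecture
R19-E), and THE EXPONENT OF THE LOCAL TOWER IS `G(M)²`:
* `G` polynomial (`PolyLogModulus`, conjecture R19-A) ⇒ single-exponential local bound
  (`singleExp_of_polyLogModulus`, PROVED modulo the two conjectures) — the qualitative threshold
  of the seat's purpose is crossed by the DEGREE of `G`, not by a Hölder exponent;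
* `G = exp(C(1+M)^θ)` (`ExpLogModulus`, print in substance: CTZ22 Prop. 1.2 + Lemma 2.1, or any
  Hölder modulus with Arrhenius exponent via `rpow_mul_logSq_le`) ⇒ double-exponential
  (`doubleExp_of_expLogModulus`, PROVED modulo R19-E) — Ożański–Palasek's `exp exp 𝒩^{O(1)}`
  height, now in the LOCAL gauge frame and with NO start exponential.
R19-A is STRICTLY WEAKER than (the pointwise shadow of) R15's `PolyHolderLaw`: a Hölder bound
`|Γ| ≤ K(1+M)^K r^{γ(M)}` gives `G ≤ 4e⁻²K(1+M)^K/γ(M)²` (`rpow_mul_logSq_le`,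
`exists_polyLogModulus_of_holderBound`, PROVED), so a polynomial Hölder exponent is MORE than the
threshold needs; conversely `|Γ| ≤ G/ln²(1/r)` is not Hölder at all.  (Reading note, memo §1b:
the last display of LZ17 p. 8 multiplies (E6) by `3C_*²` but keeps `K₀δ_*‖∇Ω‖²` unweighted on the
right; the honest absorption condition is `3C_*²K₀δ_* < 1/2`, immaterial for Cor. 1.3 and the reason
the exponent here is `G²` rather than `G`.)

**The start dissolver (why no second exponential).**  Ożański–Palasek (arXiv:2210.10030, p. 5)
pay an extra exponential to START the `(Φ, Γ) = (ω_r/r, ω_θ/r)` energy ("propagating L² control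
from the initial time would lead to an additional exponential"); Seregin 2022's local Step 3 starts
from a singularity-free slab and cuts off at regular axis heights (partial regularity —
qualitative; tree `…StubSereginLogSwirlOriginStep3KeyEstimate`: the constant is
`E(t₁) + (Bcut + …)(t₂ - t₁)` with solution-dependent `E(t₁)`, `Bcut`, `P₀,P₁,P₂`).  In the full
CKN gauge both are replaced by a POLYNOMIAL device (memo §1c, test T-19.2/3): (i) the sub-critical
space–time start `‖(J,Ω)‖_{L^{1/2}(Q)} ≤ c (1+M)^{1/2}` (R18's `p = 1/2` trick: `∫∫ r^{-2/3} < ∞`,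
enstrophy `≤ N(1+C+D)` by CTZ22 Lemma 3.1); (ii) every cut-off / commutator / far-field term of the
localised Lei–Zhang–Seregin energy identity is at most BILINEAR in sub-energy norms
(`L²`, `L^{20/7}`) of `(J, Ω, ∇(u_r/r))` against gauge-controlled factors, with interpolation
homogeneity `< 1` relative to the next cylinder's energy, or carries the small FBC-2 constant;
(iii) the hole-filling iteration lemma — PROVED here in the discrete form `absorb_iterate` and in
Giaquinta's continuous form `giaquinta_iteration` — then bounds the energy on `Q(1/2)` by
`C(θ)·(A + B)` with NO data term.  The Moser coupling problem recorded in R18 §7 (K-19.1) thereby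
DISSOLVES: no `L^p`-iteration of the coupled `(J, Ω)` system is needed, `m = 1` suffices.

Contents: §1 the log²-modulus laws and the Hölder ⇒ log² kernel; §2 the engine conjecture
`LogModulusBudget`, its `G = 0` corollary P₀ (PROVED: the `b > a` law CONTAINS R18's swirl-free law)
and the two tower corollaries; §3 the FBC dictionary (scale `δ(G)`, PROVED identities); §4 the start
dissolver (hole-filling lemmas, PROVED); §5 the appendix constants (closure weights under the
closure condition `C_*²δ_* ≤ 1/3072`, `κ₀ = 1/(3072·4096)`, `3547 ≤ 1/√κ₀ ≤ 3548`, PROVED; appendix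
HOME/ns-regularity-ideate-p2/R19-APPENDIX-TermTable.md).  No sorry, no new axioms.  Conjecture tags: `PolyLogModulus`
(R19-A), `LogModulusBudget` (R19-E).  Memo: HOME/ns-regularity-ideate-p2/ROUND-19.md.

References: Lei–Zhang arXiv:1505.02628 (Def 1.1, Thm 1.2, Cor 1.3, (2.1)–(2.2), Lemma 2.1);
Wei arXiv:1508.03318 (Cor 1.1); Seregin arXiv:2201.00153 §2; Chen–Tsai–Zhang arXiv:2201.01766
(Prop 1.2, Lemmas 2.1, 2.4, 3.1); Ożański–Palasek arXiv:2210.10030 (Thm 1.1, Props 5.1–5.2, §1.2);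
Chen–Fang–Zhang arXiv:1701.08184 / CPDE 2017; Giaquinta, *Multiple integrals…* (1983) Ch. V
Lemma 3.1 (the iteration lemma); Barker–Prange survey arXiv:2211.16215 §3.
This file: the module docstring of the companion and §1 (the log²-modulus laws, the Hölder ⇒ log²
kernel).  §2 (the engine conjecture `LogModulusBudget` and its tower) is the sibling
`…Theorems.LogModulusBudgetEngine`; §§3–5 (FBC dictionary, Giaquinta's iteration lemma, appendix
constants) are `…Theorems.LogModulusBudgetFBC` (split for the 400-line rule by the landing seat
nsreg-p4 g12; planner nsreg-p2's companion `R19-LogModulusBudget.lean` v3, sha16 76d26907de711d48,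
body otherwise verbatim).  Memo: `run/shared/lean/pub/ns-regularity-ideate/ns-regularity-ideate-p2/ROUND-19.md`
(v4, sha16 aedc782e764893a4); appendix `…/R19-APPENDIX-TermTable.md` (v3).
WHAT THIS IS NOT: not NS regularity — typed LINE material for the DORMANT route `SwirlThreshold`
(crux stmt-NavierStokesRegularity-2002): two `@[conjecture]` rungs (`PolyLogModulus` R19-A,
`LogModulusBudget` R19-E) and kernel-checked arrows between them; no crux claim.
-/

noncomputable section

namespace Summit.NavierStokesRegularity.NavierStokesRegularity.Theorems.LogModulusBudget

open MeasureTheory Set Filter Topology Metric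
open scoped ENNReal NNReal Topology
open Literature.Analysis Literature.Analysis.FluidPDE
open Summit.NavierStokesRegularity.NavierStokesRegularity.Theorems.SwirlFreeBudget

/-! ## 1. The log²-modulus of the swirl in the full CKN gauge -/

/-- The critical logarithmic weight at the axis, `ℓ(x) = ln²(1/r)`, `r = cylRadius x`.  Junk-free:
Lean's `log 0⁻¹ = 0` only drops the axis itself, where `Γ = 0` anyway
(`swirl_eq_zero_of_cylRadius_eq_zero`). -/
def logSqWeight (x : EuclideanSpace ℝ (Fin 3)) : ℝ :=
  (Real.log (cylRadius x)⁻¹) ^ 2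

/-- The log²-weight is nonnegative. -/
theorem logSqWeight_nonneg (x : EuclideanSpace ℝ (Fin 3)) : 0 ≤ logSqWeight x :=
  sq_nonneg _

/-- **`SwirlLogModulus G` — the log²-modulus law with constant `G(M)`.**  For every axisymmetric
suitable weak solution in `Q₁` in the full CKN gauge `M` (`FullGauge`: `A, C, D ≤ M` at all points
of `Q(1/2)`, scales `≤ 1/4`) and every axis point `z₀ ∈ Q(1/8)`:
`|Γ| · ln²(1/r) ≤ G(M)` a.e. on `Q(z₀, 1/4)`.  This is exactly the hypothesis Lei–Zhang's Cor. 1.3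
(`|Γ| ≤ C₁/|ln r|²`, tree fact `LeiZhang2017_logModulus_regularity`) and its FBC proof consume,
with the constant made a FUNCTION OF THE GAUGE. -/
def SwirlLogModulus (G : ℝ → ℝ) : Prop :=
  ∀ (u : ℝ → EuclideanSpace ℝ (Fin 3) → EuclideanSpace ℝ (Fin 3))
    (p : ℝ → EuclideanSpace ℝ (Fin 3) → ℝ),
    IsSuitableWeakSolutionInBall 1 0 u p →
    (∀ t ∈ Ioo (-1 : ℝ) 0, IsAxisymmetric (u t)) →
    (∀ t ∈ Ioo (-1 : ℝ) 0, IsAxisymmetricScalar (p t)) →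
    ∀ M : ℝ, 0 ≤ M → FullGauge M u p →
    ∀ z₀ ∈ parabolicCylinder (1 / 8) (0 : ℝ × EuclideanSpace ℝ (Fin 3)), cylRadius z₀.2 = 0 →
      ∀ᵐ z ∂(volume.restrict (parabolicCylinder (1 / 4) z₀)),
        |swirl (u z.1) z.2| * logSqWeight z.2 ≤ G M

/-- Monotonicity of the law in the modulus constant. -/
theorem SwirlLogModulus.mono {G G' : ℝ → ℝ} (h : SwirlLogModulus G)
    (hGG' : ∀ M, 0 ≤ M → G M ≤ G' M) : SwirlLogModulus G' := by
  intro u p hsol hax hpax M hM hFG z₀ hz₀ haxis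
  filter_upwards [h u p hsol hax hpax M hM hFG z₀ hz₀ haxis] with z hz
  exact hz.trans (hGG' M hM)

/-- **R19-A `PolyLogModulus q` (conjecture) — the log²-modulus constant is POLYNOMIAL in the gauge:**
`G(M) = c (1+M)^q`.  With the engine `LogModulusBudget` this gives a SINGLE-exponential local bound
(`singleExp_of_polyLogModulus`): the qualitative threshold of the quantitative axisymmetric theory
(loglog blow-up rate, double-exponential bounds) is crossed by the DEGREE of `G`.  Strictly weaker
than R15's polynomial Hölder law (`exists_polyLogModulus_of_holderBound`).  Why it might fail: the
only known moduli come from the De Giorgi/Nash–Moser class applied to the drift–diffusion equation of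
`Γ`, whose oscillation decrement is Arrhenius in the drift gauge (CTZ22 Lemma 2.4: `N₇ = exp(-CK^{8/(1-8β)})`),
giving `G = exp(C M^θ)`; a polynomial `G` needs an input that uses the COUPLING of `Γ` to `u`
(R15's funnel ceiling: the linear class is sharp), and the log²-weight is invisible to every
couplings-blind method. -/
@[conjecture] def PolyLogModulus (q : ℝ) : Prop :=
  ∃ c : ℝ, 0 < c ∧ SwirlLogModulus (fun M => c * (1 + M) ^ q)

/-- **`ExpLogModulus θ` — the printed regime (in substance): `G(M) = exp(C (1+M)^θ)`.**  Source:
Chen–Tsai–Zhang arXiv:2201.01766 Prop. 1.2 (`|Γ| ≤ N e^{-c(M)|ln r|^τ}`-type modulus with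
`c(M) = N₇/(4τ ln 4)`, `N₇ = exp(-C K^{8/(1-8β)})`, `K ≲ (1+M)^{5/2}` by their Lemma 2.1) combined
with `sup|Γ| ≤ N(1+A)^{5/2}` — or Ożański–Palasek arXiv:2210.10030 Prop. 5.1 (Hölder exponent
`γ = exp(-𝒩^{O(1)})`) via `rpow_mul_logSq_le`.  Not a tree theorem; typed to make the comparison
`ExpLogModulus ⇒ exp exp` / `PolyLogModulus ⇒ exp` a pair of kernel-checked arrows. -/
def ExpLogModulus (θ : ℝ) : Prop :=
  ∃ C : ℝ, 0 < C ∧ SwirlLogModulus (fun M => Real.exp (C * (1 + M) ^ θ))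

/-- **`SwirlHolderBound γ` — the pointwise shadow of R15's Hölder rung in the full gauge:**
`|Γ| ≤ K(1+M)^K · r^{γ(M)}` a.e. on `Q(z₀, 1/4)` about axis points (R15's `SwirlHolderLaw` bounds the
OSCILLATION of `Γ` on `Q(z₀, ρ)` by `K(1+M)^K ρ^{γ(M)}`; since `Γ = 0` on the axis this implies the
pointwise form off a null set; typed here independently to keep the file's imports to R18). -/
def SwirlHolderBound (γ : ℝ → ℝ) : Prop :=
  ∃ K : ℝ, 0 < K ∧
    ∀ (u : ℝ → EuclideanSpace ℝ (Fin 3) → EuclideanSpace ℝ (Fin 3))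
      (p : ℝ → EuclideanSpace ℝ (Fin 3) → ℝ),
      IsSuitableWeakSolutionInBall 1 0 u p →
      (∀ t ∈ Ioo (-1 : ℝ) 0, IsAxisymmetric (u t)) →
      (∀ t ∈ Ioo (-1 : ℝ) 0, IsAxisymmetricScalar (p t)) →
      ∀ M : ℝ, 0 ≤ M → FullGauge M u p →
      ∀ z₀ ∈ parabolicCylinder (1 / 8) (0 : ℝ × EuclideanSpace ℝ (Fin 3)), cylRadius z₀.2 = 0 →
        ∀ᵐ z ∂(volume.restrict (parabolicCylinder (1 / 4) z₀)),
          |swirl (u z.1) z.2| ≤ K * (1 + M) ^ K * (cylRadius z.2) ^ (γ M)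

/-! ### The kernel of "Hölder ⇒ log²": `r^γ ln²(1/r) ≤ 4e⁻²/γ²` -/

/-- `x e^{-x} ≤ e^{-1}` for all real `x`. -/
theorem mul_exp_neg_le (x : ℝ) : x * Real.exp (-x) ≤ Real.exp (-1) := by
  have h := Real.add_one_le_exp (x - 1)
  have hx : x ≤ Real.exp (x - 1) := by linarith
  calc x * Real.exp (-x) ≤ Real.exp (x - 1) * Real.exp (-x) := by
        gcongr
    _ = Real.exp (-1) := by rw [← Real.exp_add]; congr 1; ring

/-- **Kernel scalar lemma:** for `0 < r ≤ 1` and `γ > 0`, `r^γ · ln²(1/r) ≤ 4e⁻²/γ²`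
(maximum at `ln(1/r) = 2/γ`).  The log²-modulus constant of a `γ`-Hölder swirl is `O(γ⁻²)`:
polynomial in `1/γ`, so an Arrhenius `γ(M)` gives `G = exp(O(M^p))` and a polynomial `γ(M)` gives a
polynomial `G`. -/
theorem rpow_mul_logSq_le {r γ : ℝ} (hr : 0 < r) (hr1 : r ≤ 1) (hγ : 0 < γ) :
    r ^ γ * (Real.log r⁻¹) ^ 2 ≤ 4 * Real.exp (-2) / γ ^ 2 := by
  set s := Real.log r⁻¹ with hs_def
  have hrγ : r ^ γ = Real.exp (-(γ * s)) := by
    rw [Real.rpow_def_of_pos hr, hs_def, Real.log_inv]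
    congr 1; ring
  have hsplit : Real.exp (-(γ * s)) = Real.exp (-(γ * s / 2)) * Real.exp (-(γ * s / 2)) := by
    rw [← Real.exp_add]; congr 1; ring
  have hx := mul_exp_neg_le (γ * s / 2)
  have hx0 : 0 ≤ γ * s / 2 * Real.exp (-(γ * s / 2)) := by
    have hs0 : 0 ≤ s := Real.log_nonneg ((one_le_inv₀ hr).2 hr1)
    positivity
  have e2 : Real.exp (-2) = Real.exp (-1) ^ 2 := by
    rw [sq, ← Real.exp_add]; norm_num
  have hγne : γ ≠ 0 := hγ.ne'
  rw [hrγ, hsplit]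
  calc Real.exp (-(γ * s / 2)) * Real.exp (-(γ * s / 2)) * s ^ 2
      = 4 / γ ^ 2 * (γ * s / 2 * Real.exp (-(γ * s / 2))) ^ 2 := by
        field_simp
        ring
    _ ≤ 4 / γ ^ 2 * Real.exp (-1) ^ 2 := by
        gcongr
    _ = 4 * Real.exp (-2) / γ ^ 2 := by rw [e2]; ring

/-- Parabolic cylinders are measurable (open interval × open ball). -/
theorem measurableSet_parabolicCylinder' (r : ℝ) (z : ℝ × EuclideanSpace ℝ (Fin 3)) :
    MeasurableSet (parabolicCylinder r z) := by
  unfold parabolicCylinder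
  exact measurableSet_Ioo.prod measurableSet_ball

/-- Points of a parabolic cylinder about an AXIS point lie within the radius of the axis. -/
theorem cylRadius_lt_of_mem {ρ : ℝ} {z₀ z : ℝ × EuclideanSpace ℝ (Fin 3)}
    (h0 : cylRadius z₀.2 = 0) (hz : z ∈ parabolicCylinder ρ z₀) : cylRadius z.2 < ρ := by
  have hd : dist z.2 z₀.2 < ρ := (mem_parabolicCylinder.1 hz).2
  obtain ⟨h0', h1'⟩ := (cylRadius_eq_zero_iff z₀.2).1 h0
  have hle : cylRadius z.2 ≤ ‖z.2 - z₀.2‖ := by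
    rw [cylRadius, EuclideanSpace.norm_eq]
    apply Real.sqrt_le_sqrt
    simp only [Fin.sum_univ_three, Real.norm_eq_abs, sq_abs, PiLp.sub_apply, h0', h1', sub_zero]
    nlinarith [sq_nonneg (z.2 2 - z₀.2 2)]
  rw [dist_eq_norm] at hd
  exact hle.trans_lt hd

/-- **KERNEL ARROW (R19-A is weaker than the Hölder rung):** a Hölder bound with exponent
`γ(M) ≥ c (1+M)^{-p}` gives the log²-modulus law with the POLYNOMIAL constant
`G(M) = (4e⁻²K/c²)(1+M)^{K+2p}`. -/
theorem exists_polyLogModulus_of_holderBound {γ : ℝ → ℝ} {c p : ℝ} (hc : 0 < c) (_hp : 0 ≤ p)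
    (hγ : ∀ M, 0 ≤ M → c * (1 + M) ^ (-p) ≤ γ M) (h : SwirlHolderBound γ) :
    ∃ q : ℝ, PolyLogModulus q := by
  obtain ⟨K, hK, hb⟩ := h
  refine ⟨K + 2 * p, 4 * Real.exp (-2) * K / c ^ 2, by positivity, ?_⟩
  intro u q hsol hax hpax M hM hFG z₀ hz₀ haxis
  have hM1 : 1 ≤ 1 + M := by linarith
  have hM0 : 0 < 1 + M := by linarith
  have hγM : 0 < γ M := lt_of_lt_of_le (by positivity) (hγ M hM)
  -- `1/γ(M)² ≤ (1+M)^{2p}/c²`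
  have hinvγ : 4 * Real.exp (-2) / γ M ^ 2 ≤ 4 * Real.exp (-2) / c ^ 2 * (1 + M) ^ (2 * p) := by
    have hcp : 0 < c * (1 + M) ^ (-p) := by positivity
    have h1 : (c * (1 + M) ^ (-p)) ^ 2 ≤ γ M ^ 2 := by
      gcongr
      exact hγ M hM
    have h2 : 4 * Real.exp (-2) / γ M ^ 2 ≤ 4 * Real.exp (-2) / (c * (1 + M) ^ (-p)) ^ 2 := by
      apply div_le_div_of_nonneg_left (by positivity) (by positivity) h1
    have h3 : 4 * Real.exp (-2) / (c * (1 + M) ^ (-p)) ^ 2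
        = 4 * Real.exp (-2) / c ^ 2 * (1 + M) ^ (2 * p) := by
      rw [mul_pow, ← Real.rpow_natCast ((1 + M) ^ (-p)) 2, ← Real.rpow_mul hM0.le]
      have : (-p) * ((2 : ℕ) : ℝ) = -(2 * p) := by push_cast; ring
      rw [this, Real.rpow_neg hM0.le]
      field_simp
    linarith [h2, h3.le]
  filter_upwards [hb u q hsol hax hpax M hM hFG z₀ hz₀ haxis,
    ae_restrict_mem (measurableSet_parabolicCylinder' (1 / 4) z₀)] with z hz hzmem
  have hr0 : 0 ≤ cylRadius z.2 := cylRadius_nonneg _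
  rcases hr0.eq_or_lt with hr | hr
  · -- on the axis `Γ = 0`
    have : swirl (u z.1) z.2 = 0 := swirl_eq_zero_of_cylRadius_eq_zero _ hr.symm
    rw [this, abs_zero, zero_mul]
    positivity
  · have hr1 : cylRadius z.2 ≤ 1 :=
      ((cylRadius_lt_of_mem haxis hzmem).trans (by norm_num)).le
    have hker := rpow_mul_logSq_le hr hr1 hγM
    have hpow : 0 ≤ (cylRadius z.2) ^ γ M := Real.rpow_nonneg hr.le _
    have hw : 0 ≤ logSqWeight z.2 := logSqWeight_nonneg _
    calc |swirl (u z.1) z.2| * logSqWeight z.2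
        ≤ K * (1 + M) ^ K * (cylRadius z.2) ^ γ M * logSqWeight z.2 := by
          gcongr
      _ = K * (1 + M) ^ K * ((cylRadius z.2) ^ γ M * (Real.log (cylRadius z.2)⁻¹) ^ 2) := by
          rw [logSqWeight]; ring
      _ ≤ K * (1 + M) ^ K * (4 * Real.exp (-2) / γ M ^ 2) := by
          gcongr
      _ ≤ K * (1 + M) ^ K * (4 * Real.exp (-2) / c ^ 2 * (1 + M) ^ (2 * p)) := by
          gcongr
      _ = 4 * Real.exp (-2) * K / c ^ 2 * ((1 + M) ^ K * (1 + M) ^ (2 * p)) := by ring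
      _ = 4 * Real.exp (-2) * K / c ^ 2 * (1 + M) ^ (K + 2 * p) := by
          rw [← Real.rpow_add hM0]

end Summit.NavierStokesRegularity.NavierStokesRegularity.Theorems.LogModulusBudget

end
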